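import HarnessLib
import Summits.NavierStokesRegularity.NavierStokesRegularity.Theses.QuarterLogPincer
import Summits.NavierStokesRegularity.NavierStokesRegularity.Theorems.QuarterLogPincerCubicRungEdge
import Summits.NavierStokesRegularity.NavierStokesRegularity.Theorems.QuarterLogPincerBeadCensusKernel
import Summits.NavierStokesRegularity.NavierStokesRegularity.Theorems.QuarterLogPincerEmberCensusKernel
import Summits.NavierStokesRegularity.NavierStokesRegularity.Theorems.QuarterLogPincerEmberCensusHotWitnessFar
import Summits.NavierStokesRegularity.NavierStokesRegularity.Theorems.QuarterLogPincerTypeIQuantSubcubicExpStubUniformScaledEnergy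

/-!
# LINE `ember_census` (ns-idea-7 g12–g13, lens «nearmiss», target «DSS wall») — crux
`QuarterLogPincer.TypeIQuantSubcubicExp` (stmt-NavierStokesRegularity-24077, LADDER-NS wall W7)

**No summit is proved by this line.**  v1.2 (2026-08-29, g13; director-ns dss_141/143/147, ns-afl-r1 typed note
06:16Z, typer g38 wiring): (α) BY NAME — every object and kernel that the pub-ns-dss typer homed in the tree is now
IMPORTED, not restated: the rung `CubicRung.TypeIQuantCubicExp` and the crux→rung edge
`CubicRung.typeIQuantCubicExp_of_typeIQuantSubcubicExp` (`…CubicRungDefs/Edge`, p701084/p701791), the level objects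
and G1♯/G2 `BeadCensus.levelScale … FlarePersistence, BPChainRate` with the ten accounting kernels
(`…BeadCensusDefs/Kernel`, p707235), the ember objects `EmberCensus.Hot`, `Terminal`, E2 `TerminalEmber` and K1
`exists_terminal_descendant` (`…EmberCensusDefs/Kernel`), and E1a `EmberCensus.hotWitness_far` (p704006); the four
restated decls of v1.1 (§0, §1, §3/§3♯, §4♭/§4 copies) are DELETED.  (β) E1 SPLIT — E1 `HotWitness` (text byte-identical
to v1.1) is no longer a stub: it is DERIVED (`hotWitness_of_far_of_near`, `Γ := max Γ₀ Γ₁`, case split on the clock at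
`t₁`) from E1a `HotWitnessFar` (= the tree THEOREM `hotWitness_far`, clock-far case, threshold quantified UPWARD) and the
new stub E1b `HotWitnessNear` (clock-near case `T'−t₁ ≤ r²`: the ε-cold ⇒ regular port; its discharge to tree theorems
is line `cold_smoothing`, g13).  (γ) E2♭ — the load-bearing stub of record is WEAKENED to `TerminalEmberM`: the
ε-regularity cap may depend on the rate (`∀ M, ∃ ε₁(M), ∀ ε ≤ ε₁`); K2 fixes `M` before it asks E1 for a threshold
below the cap, so the `M`-uniform `ε₀` of E2 was unneeded strength; `terminalEmberM_of_terminalEmber : TerminalEmber →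
TerminalEmberM` keeps the sister lines `silencing_cost` / `smooth_silence` (which conclude E2 BY NAME) plugged in.
Sorries = exactly `stub_hotWitnessNear` (E1b, M), `stub_terminalEmberM` (E2♭, L), `stub_bpChainRate` (G2, XL).
v1.1 (05:20Z): E2 restricted to the ε-regularity regime `ε ≤ ε₀` with a room factor `Λ`; E1 produces its threshold
below any cap.  It bears on the rung `R := CubicRung.TypeIQuantCubicExp` (`log F_M(A) ≤ K_M A³`, KEY-NS #191 «W7.R0
rate», tree edge `CubicRung.typeIQuantCubicExp_of_typeIQuantSubcubicExp`) and its target BY NAME is line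
`bead_census`'s conjectural crux-let **`BeadCensus.FlarePersistence`** (G1♯), which this file turns into a THEOREM
(`flarePersistence_of_stubs`) modulo E1b and E2♭, whose mechanisms are ε-regularity and Carleman unique
continuation for a LINEAR equation with BOUNDED coefficients — no Type-I criticality, no small constant, no
Liouville, no compactness.

## Near-miss of record, measured deficit, single input
* Near-miss: `bead_census` v1.2 (critic PASS 2026-08-29T04:07Z) proves `FlarePersistence → BeadCensus` and
  `BeadCensus → BPChainRate → R` in the kernel (tree: `BeadCensus.typeIQuantCubicExp_of_flarePersistence_of_bpChainRate`);
  its ONE conjectural input is `FlarePersistence` («a bad level leaves ≥ c(M,μ,a) of cube trace in its frozen shell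
  at the evaluation time»), with the enemy named in its docstring: BURN-OUT FLARES.
* Measured deficit: persistence was asked FLARE BY FLARE, from the final-time ball of the flare itself.  That
  local statement is false already for the heat equation (interior null-controllability from the lateral
  boundary), so no lemma of that shape exists.
* Single input (this line): ask persistence only at TERMINAL hot events and in a THICK box.  A hot event
  `(y,t)` (`ε < √(T'−t)·‖u(t,y)‖`, `T' = T+τ` the virtual blow-up time) is TERMINAL when no hot event follows it
  within `4K√(T'−t)` at clock `≤ √(T'−t)/2`.  Every hot event has a terminal descendant within `8K√(T'−t)`
  (tree kernel `EmberCensus.exists_terminal_descendant`).  A terminal event's box `B(y,4Kσ) × (t−σ², t₁]`,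
  `σ = √(T'−t)`, is QUANTITATIVELY REGULAR (`|u| ≤ M₁(M)/σ`): down to clock `σ√3/4` by the Type-I rate, below it
  because every point is ε-cold and pointwise coldness `|u| ≤ ε/√(T'−s)` makes the Gustafson–Kang–Tsai
  `(p,q) = (∞,1)` quantity `ρ⁻¹∫ sup_{B_ρ}|u| dt ≤ 2ε` at EVERY scale `ρ` (the `L¹`-in-time norm integrates the
  clock) [corpus:paper:arxiv-math_0607114 p.2 Thm 1.1(i)], whence `C(ρ) ≤ A(ρ)·G(ρ) ≤ 2εC(M)` by the tree's PROVED
  I1 `ThinCascade.stub_uniformScaledEnergy` and ONE step of the tree's PROVED pressure decay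
  `seregin_sverak_pressure_decay_holds` + the PROVED `seregin2014_lemma61_holds` give `C²` bounds (line
  `cold_smoothing`).  In a regular box a hot centre is VORTICAL (STREAMS ARE EXCLUDED BY I1, no use of `A`), and
  enstrophy at the centre of a regular box of thickness `Kσ` cannot be driven below `c₂(M)` within time `≤ 2σ²`
  [Carleman: Tao 2021 Prop. 4.3, corpus:paper:tao2021-quantitative-bounds-critically-bounded-solutions-navier-stokes
  p.32; Escauriaza–Fernández–Vessella arXiv:math/0611462 Thm 2–3; the ESS backward-uniqueness class; line
  `silencing_cost` cuts it at its joints, line `smooth_silence` types the parabolic-inequality form].  Hence an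
  EMBER: `c(M,ε) ≤ ∫_{B(y,Kσ)}|u(t₁)|³`.
* Census geometry (kernel K2, `flarePersistence_of_hotWitness_of_terminalEmberM`): for a bad level `k+1` the
  candidate annulus `R := 4M√s + (1+27K)Γ√s` is violated, E1 yields a hot witness near it in the last `4Γ²s` of
  time, K1 its terminal descendant (drift `≤ 24KΓ√s`), E2♭ the ember (radius `≤ 3KΓ√s`), and the ember ball lies
  inside `levelShell (k+1)` once `a ≥ a₀ := M^{10μ}(4M+(1+27K)Γ)+(1+27K)Γ+(4+5Λ)Γ²`.  Then `bead_census`'s tree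
  kernels give `BeadCensus` and, with G2 `BPChainRate`, the rung R.

## Board (v1.2)
E1a `HotWitnessFar` (TREE THEOREM `hotWitness_far`) ⊕ E1b `HotWitnessNear` (stub, M; discharge: line `cold_smoothing`)
⇒ E1 `HotWitness` (`hotWitness_of_far_of_near`);  E2 `TerminalEmber` (sister lines) ⇒ E2♭ `TerminalEmberM` (stub of
record, L);  E1 + E2♭ ⇒ `BeadCensus.FlarePersistence` (K1 tree + K2 here) ⇒ `BeadCensus` (tree) + G2
`BeadCensus.BPChainRate` (stub, XL, published) ⇒ `CubicRung.TypeIQuantCubicExp` (tree kernel;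
`typeIQuantCubicExp_of_stubs`, sorries = exactly the three stubs).

## Why this line / why novel
* vs `bead_census` (g11-2): same census, but its conjecture G1♯ is DISCHARGED to bounded-coefficient linear
  analysis; the residual stub E2♭ is not NS-critical.  vs `cubic_rung` (g11-1): no Liouville floor, no
  compactness.  vs `thin_cascade`/`ab_root`/`quiet_*`/`truncation_edge`: nothing extracted, no edge at the
  apex; I1 and ε-regularity are used as TOOLS at satellite events, not at the cascade tip.  vs routes
  QuarterLogPincer / TypeIQuarterGate: no DSS hypothesis; BELOW the wall (each stub is consistent with DSS).
* New lever (five words): terminal hot events leave embers.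
* bears_on: W7 rung «R0-rate» (KEY-NS #191, `CubicRung.TypeIQuantCubicExp`).  Instrument row (pub-ns-dss, extends
  «outer-shell flare census»): per Type-I candidate run, for each terminal hot event (ε = 10⁻², K = 8) the final
  cube in `B(y, K√(T'−t))`; EMBERS-PRESENT = all ≥ 10⁻⁶ at the two finest resolutions; EMBERS-VANISH = a terminal
  event whose final cube → 0 under refinement at fixed M (kills E2♭).
* Cheapest falsifier: a smooth Type-I (sup-rate `M`) family with a terminal ε-hot event whose box
  `B(y,K√(T'−t))` carries final cube `→ 0` for every fixed `K` — refutes `stub_terminalEmberM`; it would have to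
  exhibit interior null-control at cost below `e^{cK²}` for a LINEAR parabolic equation with bounded drift —
  checkable on the heat equation with drift first.  E1b's falsifier: none expected (published mechanism + tree
  theorems); a cold cylinder with `‖∇²u‖ ≫ r⁻³` in a Type-I classical solution would contradict CKN.
-/

set_option linter.dupNamespace false

namespace Summit.NavierStokesRegularity.NavierStokesRegularity.Cruxes.TypeIQuantSubcubicExp.EmberCensus

noncomputable section

open MeasureTheory Set Function Filter Topology Metric
open scoped ENNReal NNReal Classical
open Literature.Analysis Literature.Analysis.FluidPDE
open Summit.NavierStokesRegularity.NavierStokesRegularity.Cruxes.TypeIQuantSubcubicExp.CubicRung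
  (QuantCubicExpAt TypeIQuantCubicExp quantCubicExpAt_antitone typeIQuantCubicExp_of_typeIQuantSubcubicExp)
open Summit.NavierStokesRegularity.NavierStokesRegularity.Cruxes.TypeIQuantSubcubicExp.BeadCensus

local notation "E3" => EuclideanSpace ℝ (Fin 3)

/-! ## 0. By-name anchors (v1.2): the rung, the crux→rung edge, the level objects and the ember objects are the
tree's decls of record; nothing is restated.  The `example`s only certify that the names resolve to the intended
statements. -/

example : Summit.NavierStokesRegularity.NavierStokesRegularity.Theses.QuarterLogPincer.TypeIQuantSubcubicExp →
    TypeIQuantCubicExp :=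
  typeIQuantCubicExp_of_typeIQuantSubcubicExp

example : FlarePersistence → BPChainRate → TypeIQuantCubicExp :=
  typeIQuantCubicExp_of_flarePersistence_of_bpChainRate

example (a t₁ : ℝ) (k : ℕ) : levelScale a t₁ k = t₁ * Real.exp (-2 * a * k) := rfl

example (ε T' : ℝ) (u : ℝ → E3 → E3) (y : E3) (t : ℝ) :
    Hot ε T' u y t ↔ (T' - t ≤ t ∧ ε < Real.sqrt (T' - t) * ‖u t y‖) := Iff.rfl

/-! ## 3. G2 — the stub carried from `bead_census` (by name: `BeadCensus.BPChainRate`) -/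

/-- STUB G2 (XL, published mechanisms): see `BeadCensus.BPChainRate` (`…Theorems.QuarterLogPincerBeadCensusDefs`). -/
theorem stub_bpChainRate : BPChainRate := by
  sorry

/-! ## E. EMBERS — E1 = E1a ⊕ E1b, E2♭, and the kernel K2 (`Hot`, `Terminal`, E2 `TerminalEmber`, K1
`exists_terminal_descendant` are the tree's, this namespace: `…Theorems.QuarterLogPincerEmberCensusDefs/Kernel`) -/

/-! ### E1 — `HotWitness` (text byte-identical to v1.1; v1.2: DERIVED from E1a ⊕ E1b below, no longer a stub) -/

/-- **E1 — `HotWitness` (size M; PUBLISHED MECHANISMS; no wall; `A`-free).**  For `μ > 0`, `M ≥ 1` and any cap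
`ε₀ > 0` there are `0 < ε = ε(μ,M,ε₀) ≤ ε₀` and `Γ = Γ(μ,M,ε₀) ≥ 1` (v1.1: the threshold is produced BELOW
any prescribed cap, so that E2 may restrict to the ε-regularity regime `ε ≤ ε₀`) such that in the crux frame with the virtual Type-I rate `M`: if a
CANDIDATE ANNULUS `{R < |x−x₀| < M^{10μ}R}` of level `k+1` (`4M√s ≤ R`, `M^{10μ}R ≤ e^{a}√s`,
`s = levelScale a t₁ (k+1)`, room `9Γ²s ≤ t₁`) is NOT quiet on the final window `[t₁ − s/32, t₁]`, then an
ε-HOT EVENT sits within `r := Γ√s` of the annulus during the last `4r²` of time, at clock `≤ √5·r`.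
Mechanism (contrapositive): (i) if `T'−t₁ > r²` every point of the window has clock `> r`, the rate gives
`|u| ≤ M/r ≤ M^{-3μ}/√s` and Kiselev–Ladyzhenskaya/KNSS interior smoothing the two derivative bounds once
`Γ ≥ C_j^{1/(j+1)} M^{1+3μ}` — no violation; (ii) else, if every `(y,t)` with `t₁−4r² ≤ t ≤ t₁`,
`R−r ≤ |y−x₀| ≤ M^{10μ}R+r` were ε-cold, then on each `Q_{r}(x,t₁)`, `x` in the annulus, the GKT `(∞,1)`
quantity is `≤ 2ε` at every `ρ ≤ r/2` around every point [corpus:paper:arxiv-math_0607114 p.2 Thm 1.1(i),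
region III: `p = ∞`, `1 ≤ q ≤ 2`, `ε` depends on `(p,q)` only]; GKT's local-energy iteration, SEEDED by the
tree's proved `ThinCascade.UniformScaledEnergy` (`stub_uniformScaledEnergy`: `A, E, D ≤ C(M)` at every
vertex and scale, from the rate alone — applied to the frame restricted to `[0,t]`, `frame_restrict` /
`typeI_restrict`), reaches the Caffarelli–Kohn–Nirenberg threshold after `O(log(C(M)/ε))` halvings, whence
`‖∇ʲu‖ ≤ C_j(M) r^{-(j+1)} ≤ M^{-3μ} s^{-(j+1)/2}` on the annulus × window for `Γ ≥ Γ(μ,M)` — no violation.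
Why it might fail: not as mathematics (each step is in print; the seed I1 is in the tree); porting cost M
(GKT's iteration with an explicit constant).  Sources: Gustafson–Kang–Tsai CMP 2007 (arXiv:math/0607114)
Thm 1.1; [CaffarelliKohnNirenberg1982]; I1 = `Theorems/QuarterLogPincerTypeIQuantSubcubicExpStubUniformScaledEnergy.lean`. -/
def HotWitness : Prop :=
  ∀ μ M ε₀ : ℝ, 0 < μ → 1 ≤ M → 0 < ε₀ → ∃ ε Γ : ℝ, 0 < ε ∧ ε ≤ ε₀ ∧ 1 ≤ Γ ∧
    ∀ (T τ : ℝ) (u : ℝ → E3 → E3) (p : ℝ → E3 → ℝ),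
      (IsClassicalNSSolutionOn (Icc 0 T) 1 0 u p ∧
          ∀ m : ℕ, ∃ C : NNReal, ∀ t ∈ Icc 0 T, eLpNorm (iteratedFDeriv ℝ m (u t)) 2 volume ≤ C) →
        0 < τ →
        (∀ t ∈ Icc 0 T, ∀ x : E3, ‖u t x‖ ≤ M * (T + τ - t) ^ (-(1 / 2 : ℝ))) →
        ∀ (a t₁ : ℝ) (x₀ : E3) (k : ℕ) (R : ℝ), t₁ ∈ Ioc 0 T →
          9 * (Γ * Real.sqrt (levelScale a t₁ (k + 1))) ^ 2 ≤ t₁ →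
          4 * M * Real.sqrt (levelScale a t₁ (k + 1)) ≤ R →
          M ^ (10 * μ) * R ≤ Real.exp a * Real.sqrt (levelScale a t₁ (k + 1)) →
          (¬ ∀ t ∈ Icc (t₁ - levelScale a t₁ (k + 1) / 32) t₁, ∀ x : E3,
              R < ‖x - x₀‖ → ‖x - x₀‖ < M ^ (10 * μ) * R → ∀ j : ℕ, j ≤ 2 →
                ‖iteratedFDeriv ℝ j (u t) x‖ ≤
                  M ^ (-(3 * μ)) * (levelScale a t₁ (k + 1)) ^ (-(((j : ℝ) + 1) / 2))) →
          ∃ (y : E3) (t : ℝ), Hot ε (T + τ) u y t ∧ t ≤ t₁ ∧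
            t₁ - 4 * (Γ * Real.sqrt (levelScale a t₁ (k + 1))) ^ 2 ≤ t ∧
            T + τ - t ≤ 5 * (Γ * Real.sqrt (levelScale a t₁ (k + 1))) ^ 2 ∧
            R - Γ * Real.sqrt (levelScale a t₁ (k + 1)) ≤ ‖y - x₀‖ ∧
            ‖y - x₀‖ ≤ M ^ (10 * μ) * R + Γ * Real.sqrt (levelScale a t₁ (k + 1))

/-! ### E1a — the CLOCK-FAR half of E1 is a THEOREM (tree: `EmberCensus.hotWitness_far`, p704006) -/

/-- **E1a — `HotWitnessFar`** (director-ns dss_141 (1): E1 := E1a ⊕ E1b; THE TREE'S THEOREM `hotWitness_far`, restated as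
a Prop with `levelScale` folded — `stub_hotWitnessFar` below is `hotWitness_far` by `rfl`-unfolding, NO sorry).  Clock-far
case `(Γ√s)² < T'−t₁`: every point of `[0,t₁]` has clock `> r = Γ√s`, the rate is a GLOBAL speed bound `M/r`, and KNSS
smoothing of bounded classical solutions (`exists_norm_iteratedFDeriv_le_of_speed_le`) makes the annulus (indeed all of
space) quiet for `Γ ≥ Γ₀(μ,M)`; threshold quantified UPWARD (`∃ Γ₀, ∀ Γ ≥ Γ₀`) so that it recombines with any E1b by
`Γ := max Γ₀ Γ₁` (ns-afl-r1 typed note 06:16Z). -/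
def HotWitnessFar : Prop :=
  ∀ μ M : ℝ, 0 < μ → 1 ≤ M → ∃ Γ₀ : ℝ, 1 ≤ Γ₀ ∧ ∀ Γ : ℝ, Γ₀ ≤ Γ →
    ∀ (T τ : ℝ) (u : ℝ → E3 → E3) (p : ℝ → E3 → ℝ),
      (IsClassicalNSSolutionOn (Icc 0 T) 1 0 u p ∧
          ∀ m : ℕ, ∃ C : NNReal, ∀ t ∈ Icc 0 T, eLpNorm (iteratedFDeriv ℝ m (u t)) 2 volume ≤ C) →
        0 < τ →
        (∀ t ∈ Icc 0 T, ∀ x : E3, ‖u t x‖ ≤ M * (T + τ - t) ^ (-(1 / 2 : ℝ))) →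
        ∀ (a t₁ : ℝ) (x₀ : E3) (k : ℕ) (R : ℝ), t₁ ∈ Ioc 0 T →
          9 * (Γ * Real.sqrt (levelScale a t₁ (k + 1))) ^ 2 ≤ t₁ →
          4 * M * Real.sqrt (levelScale a t₁ (k + 1)) ≤ R →
          M ^ (10 * μ) * R ≤ Real.exp a * Real.sqrt (levelScale a t₁ (k + 1)) →
          (Γ * Real.sqrt (levelScale a t₁ (k + 1))) ^ 2 < T + τ - t₁ →
          ∀ t ∈ Icc (t₁ - levelScale a t₁ (k + 1) / 32) t₁, ∀ x : E3,
            R < ‖x - x₀‖ → ‖x - x₀‖ < M ^ (10 * μ) * R → ∀ j : ℕ, j ≤ 2 →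
              ‖iteratedFDeriv ℝ j (u t) x‖ ≤
                M ^ (-(3 * μ)) * (levelScale a t₁ (k + 1)) ^ (-(((j : ℝ) + 1) / 2))

/-- E1a is the tree's theorem `EmberCensus.hotWitness_far` (no sorry; `levelScale a t₁ (k+1)` unfolds to
`t₁ * Real.exp (-2 * a * ↑(k + 1))` by `rfl`). -/
theorem stub_hotWitnessFar : HotWitnessFar := fun μ M hμ hM => hotWitness_far μ M hμ hM

/-! ### E1b — the CLOCK-NEAR half (stub; size M; PUBLISHED MECHANISMS + TREE THEOREMS; no wall; `A`-free) -/

/-- **E1b — `HotWitnessNear`** (director-ns dss_141 (1); afl-r1: `Γ` quantified upward, `ε` produced below any cap and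
BEFORE `Γ₁`).  For `μ > 0`, `M ≥ 1`, any cap `ε₀ > 0` there are `0 < ε = ε(M,ε₀) ≤ ε₀` and `Γ₁ = Γ₁(μ,M) ≥ 1` such that
for every `Γ ≥ Γ₁`, in the crux frame with virtual rate `M`: if a candidate annulus of level `k+1` (room `9Γ²s ≤ t₁`,
guards as in E1) is NOT quiet on the final window and the clock at `t₁` is NEAR, `T'−t₁ ≤ (Γ√s)²`, then an ε-HOT EVENT
`(y,t)` sits within `r := Γ√s` of the annulus during the last `4r²` of time, at clock `≤ √5·r`.  Mechanism
(contrapositive = «ε-cold cylinders are quantitatively regular», line `cold_smoothing`): if every `(y,t)` with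
`t₁−4r² ≤ t ≤ t₁`, `R−r ≤ |y−x₀| ≤ M^{10μ}R+r` is not hot then — the room clause `T'−t ≤ 5r² ≤ t₁−4r² ≤ t` being automatic
— it is ε-COLD, `√(T'−t)‖u(t,y)‖ ≤ ε`; for `x` in the annulus and `t' ∈ [t₁−s/32, t₁]` the cylinder `Q_r(x,t')` is cold, so
(i) the GKT `(∞,1)` quantity `G(ρ) = ρ⁻¹∫_{t'−ρ²}^{t'} sup_{B_ρ(x)}|u| ≤ ρ⁻¹ε∫(T'−t)^{-1/2}dt ≤ 2ε` at EVERY `ρ ≤ r`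
[corpus:paper:arxiv-math_0607114 p.2 Thm 1.1(i)]; (ii) `C(ρ) = ρ⁻²∬_{Q_ρ}|u|³ ≤ A(ρ)·G(ρ) ≤ 2εC(M)` with `A(ρ) ≤ C(M)`
the tree's PROVED I1 (`ThinCascade.stub_uniformScaledEnergy`, frame restricted to `[0,t']`, `frame_restrict` /
`typeI_restrict`); (iii) I1's pressure clause is `D(r; p̃) ≤ C(M)` for the gauge-shifted pressure `p̃ = p − ⨍_{B_r(x)}p(t)`
(still a pressure: `∇p̃ = ∇p`), and ONE step of the tree's PROVED pressure decay `D(θr; p̃) ≤ c(θD(r; p̃) + θ⁻²C(r))`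
(`seregin_sverak_pressure_decay_holds`, Seregin–Šverák 2009 (as13)) with `θ = θ(M) := ε⋆/(4cC(M))` and
`ε ≤ ε₁(M) := ε⋆θ²/(16(1+c)C(M))` gives `C(θr) + D(θr) < ε⋆`; (iv) the tree's PROVED higher ε-regularity
`seregin2014_lemma61_holds` (Seregin 2014 L.6.1 = NRŠ 1996 Prop. 2.1, absolute `c₀(j)`) on the `θr`-zoom
(`isSuitableWeakSolutionInBall_of_classical'`, `SpaceTimeRescaling`) yields `‖∇ʲu(t',x)‖ ≤ c₀(j)(θr/2)^{-(j+1)}`, i.e.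
`≤ M^{-3μ}s^{-(j+1)/2}` once `Γ ≥ Γ₁(μ,M) := 2·max_j (c₀(j)M^{3μ})^{1/(j+1)}/θ(M)` — no violation.  `ε` depends on `M`
(not on `μ`, `Γ`), which E1's quantifier order allows.  Why it might fail: not as mathematics (every step is a tree
theorem or Hölder); porting cost M (Fubini between I1's iterated integrals and `cknC`/`cknD`, the gauge shift, the zoom).
Sources: Gustafson–Kang–Tsai CMP 2007 (arXiv:math/0607114) Thm 1.1(i); [SereginSverak2009] (as13); [Seregin2014] L.6.1;
tree `PressureDecayEstimateProofs`, `SereginEpsilonRegularityHigherHolds`, `ClassicalTopPointCubic`,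
`QuarterLogPincerTypeIQuantSubcubicExpStubUniformScaledEnergy`. -/
def HotWitnessNear : Prop :=
  ∀ μ M ε₀ : ℝ, 0 < μ → 1 ≤ M → 0 < ε₀ → ∃ ε : ℝ, 0 < ε ∧ ε ≤ ε₀ ∧ ∃ Γ₁ : ℝ, 1 ≤ Γ₁ ∧ ∀ Γ : ℝ, Γ₁ ≤ Γ →
    ∀ (T τ : ℝ) (u : ℝ → E3 → E3) (p : ℝ → E3 → ℝ),
      (IsClassicalNSSolutionOn (Icc 0 T) 1 0 u p ∧
          ∀ m : ℕ, ∃ C : NNReal, ∀ t ∈ Icc 0 T, eLpNorm (iteratedFDeriv ℝ m (u t)) 2 volume ≤ C) →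
        0 < τ →
        (∀ t ∈ Icc 0 T, ∀ x : E3, ‖u t x‖ ≤ M * (T + τ - t) ^ (-(1 / 2 : ℝ))) →
        ∀ (a t₁ : ℝ) (x₀ : E3) (k : ℕ) (R : ℝ), t₁ ∈ Ioc 0 T →
          9 * (Γ * Real.sqrt (levelScale a t₁ (k + 1))) ^ 2 ≤ t₁ →
          4 * M * Real.sqrt (levelScale a t₁ (k + 1)) ≤ R →
          M ^ (10 * μ) * R ≤ Real.exp a * Real.sqrt (levelScale a t₁ (k + 1)) →
          T + τ - t₁ ≤ (Γ * Real.sqrt (levelScale a t₁ (k + 1))) ^ 2 →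
          (¬ ∀ t ∈ Icc (t₁ - levelScale a t₁ (k + 1) / 32) t₁, ∀ x : E3,
              R < ‖x - x₀‖ → ‖x - x₀‖ < M ^ (10 * μ) * R → ∀ j : ℕ, j ≤ 2 →
                ‖iteratedFDeriv ℝ j (u t) x‖ ≤
                  M ^ (-(3 * μ)) * (levelScale a t₁ (k + 1)) ^ (-(((j : ℝ) + 1) / 2))) →
          ∃ (y : E3) (t : ℝ), Hot ε (T + τ) u y t ∧ t ≤ t₁ ∧
            t₁ - 4 * (Γ * Real.sqrt (levelScale a t₁ (k + 1))) ^ 2 ≤ t ∧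
            T + τ - t ≤ 5 * (Γ * Real.sqrt (levelScale a t₁ (k + 1))) ^ 2 ∧
            R - Γ * Real.sqrt (levelScale a t₁ (k + 1)) ≤ ‖y - x₀‖ ∧
            ‖y - x₀‖ ≤ M ^ (10 * μ) * R + Γ * Real.sqrt (levelScale a t₁ (k + 1))

/-- STUB E1b (M; published mechanisms + tree theorems; discharge: line `cold_smoothing`): see `HotWitnessNear`. -/
theorem stub_hotWitnessNear : HotWitnessNear := by
  sorry

/-- **E1 = E1a ⊕ E1b (kernel-checked; v1.2).**  `Γ := max Γ₀ Γ₁`; the clock at `t₁` is either far (`r² < T'−t₁`: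
E1a says the annulus IS quiet — contradiction, nothing to find) or near (`T'−t₁ ≤ r²`: E1b's witness). -/
theorem hotWitness_of_far_of_near (hfar : HotWitnessFar) (hnear : HotWitnessNear) : HotWitness := by
  intro μ M ε₀ hμ hM hε₀
  obtain ⟨ε, hε, hεle, Γ₁, hΓ₁, hN⟩ := hnear μ M ε₀ hμ hM hε₀
  obtain ⟨Γ₀, hΓ₀, hF⟩ := hfar μ M hμ hM
  refine ⟨ε, max Γ₀ Γ₁, hε, hεle, le_trans hΓ₁ (le_max_right _ _), ?_⟩
  intro T τ u p hframe hτ hrate a t₁ x₀ k R ht₁ hroom hR₁ hR₂ hviol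
  by_cases hle : T + τ - t₁ ≤ (max Γ₀ Γ₁ * Real.sqrt (levelScale a t₁ (k + 1))) ^ 2
  · exact hN (max Γ₀ Γ₁) (le_max_right _ _) T τ u p hframe hτ hrate a t₁ x₀ k R ht₁ hroom hR₁ hR₂ hle hviol
  · exact absurd (hF (max Γ₀ Γ₁) (le_max_left _ _) T τ u p hframe hτ hrate a t₁ x₀ k R ht₁ hroom hR₁ hR₂
      (lt_of_not_ge hle)) hviol

/-- E1 with E1a (tree theorem) and E1b (stub) plugged in — NOT a sorry of its own (sorry = `stub_hotWitnessNear`). -/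
theorem stub_hotWitness : HotWitness := hotWitness_of_far_of_near stub_hotWitnessFar stub_hotWitnessNear

/-! ### E2♭ — `TerminalEmberM`: the load-bearing stub of record, WEAKER than E2 (v1.2) -/

/-- **E2♭ — `TerminalEmberM` (size L; THE LINE'S LOAD-BEARING LEMMA; no wall; `A`-free).**  As E2 `TerminalEmber`
(tree `…EmberCensusDefs`, mechanism (a)–(d) in its docstring: regular aftermath / vortical centre / cost of
silencing / readout) EXCEPT that the ε-regularity cap may depend on the rate: `∀ M ≥ 1, ∃ ε₁ = ε₁(M) > 0, ∀ 0 < ε ≤ ε₁,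
∃ K c Λ`.  Why weaker suffices: K2 fixes `M` first, takes E2♭'s cap `ε₁(M)`, and asks E1 for a threshold `ε ≤ ε₁(M)`
(E1 produces one below ANY cap).  Why it matters: step (a) (regular aftermath, Sa of `silencing_cost`) is then
reachable by ONE pressure-decay step with `ε ≤ ε₁(M)` (line `cold_smoothing`), instead of the Gustafson–Kang–Tsai
contraction needed for an `M`-uniform cap.  `TerminalEmber → TerminalEmberM` (`terminalEmberM_of_terminalEmber`).
Why it might fail / sources / killed by: as E2 (step (c), the thick-box silencing cost: Tao 2021 Prop. 4.3,
corpus:paper:tao2021-quantitative-bounds-critically-bounded-solutions-navier-stokes p.32; arXiv:math/0611462 Thm 2–3;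
ESS backward uniqueness; a smooth Type-I family with a terminal ε-hot event whose box cube at `t₁` → 0 for every
fixed `K` kills it). -/
def TerminalEmberM : Prop :=
  ∀ M : ℝ, 1 ≤ M → ∃ ε₁ : ℝ, 0 < ε₁ ∧ ∀ ε : ℝ, 0 < ε → ε ≤ ε₁ → ∃ K c Λ : ℝ, 1 ≤ K ∧ 0 < c ∧ 1 ≤ Λ ∧
    ∀ (T τ : ℝ) (u : ℝ → E3 → E3) (p : ℝ → E3 → ℝ),
      (IsClassicalNSSolutionOn (Icc 0 T) 1 0 u p ∧
          ∀ m : ℕ, ∃ C : NNReal, ∀ t ∈ Icc 0 T, eLpNorm (iteratedFDeriv ℝ m (u t)) 2 volume ≤ C) →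
        0 < τ →
        (∀ t ∈ Icc 0 T, ∀ x : E3, ‖u t x‖ ≤ M * (T + τ - t) ^ (-(1 / 2 : ℝ))) →
        ∀ (t₁ : ℝ) (y : E3) (t : ℝ), t₁ ∈ Ioc 0 T → t ≤ t₁ → Λ * (T + τ - t) ≤ t →
          Hot ε (T + τ) u y t → Terminal K ε (T + τ) t₁ u y t →
          ENNReal.ofReal c ≤ ∫⁻ x in ball y (K * Real.sqrt (T + τ - t)), ‖u t₁ x‖ₑ ^ (3 : ℝ)

/-- E2 ⇒ E2♭ (the sister lines `silencing_cost` / `smooth_silence` conclude E2 `TerminalEmber` BY NAME and plug in here). -/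
theorem terminalEmberM_of_terminalEmber (h : TerminalEmber) : TerminalEmberM := by
  obtain ⟨ε₀, hε₀, hE⟩ := h
  intro M hM
  exact ⟨ε₀, hε₀, fun ε hε hεle => hE ε M hε hεle hM⟩

/-- STUB E2♭ (L, the line's lemma): see `TerminalEmberM`. -/
theorem stub_terminalEmberM : TerminalEmberM := by
  sorry

/-! ### E.K2  Kernel: `HotWitness → TerminalEmberM → FlarePersistence` (shell geometry; body = v1.1 verbatim after
the first three `obtain`s) -/

/-- **THE LINE'S EDGE (kernel-checked): E1 + E2♭ ⇒ G1♯ `BeadCensus.FlarePersistence`.**  For a bad level `k+1` the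
candidate annulus `R := 4M√s + (1+27K)Γ√s` is violated; E1 gives a hot witness within `r = Γ√s` of it in the
last `4r²` of time (clock `≤ 3r`); K1 its terminal descendant (drift `≤ 24Kr`); E2♭ an ember of radius `≤ 3Kr`;
the ember ball lies in `levelShell (k+1)` because `a ≥ a₀ := M^{10μ}(4M+(1+27K)Γ) + (1+27K)Γ + (4+5Λ)Γ²`
makes `e^{a} > a ≥` the outer coefficient and `(4+5Λ)Γ²e^{-2a} ≤ 1` the room. -/
theorem flarePersistence_of_hotWitness_of_terminalEmberM (h1 : HotWitness) (h2 : TerminalEmberM) :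
    FlarePersistence := by
  intro μ M hμ hM
  obtain ⟨ε₀, hε₀, hE0⟩ := h2 M hM
  obtain ⟨ε, Γ, hε, hεle, hΓ, hW⟩ := h1 μ M ε₀ hμ hM hε₀
  obtain ⟨K, c, Λ, hK, hc, hΛ, hE⟩ := hE0 ε hε hεle
  have hΛ0 : 0 ≤ Λ := by linarith
  have hM0 : 0 < M := by linarith
  have hΘ0 : 0 ≤ M ^ (10 * μ) := Real.rpow_nonneg hM0.le _
  have hK0 : 0 ≤ K := by linarith
  have hΓ0 : 0 ≤ Γ := by linarith
  have h27 : 0 ≤ (1 + 27 * K) * Γ := mul_nonneg (by linarith) hΓ0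
  have hin : 0 ≤ 4 * M + (1 + 27 * K) * Γ := by linarith
  have hΘsum : 0 ≤ M ^ (10 * μ) * (4 * M + (1 + 27 * K) * Γ) := mul_nonneg hΘ0 hin
  have hΓ2 : 0 ≤ (4 + 5 * Λ) * Γ ^ 2 := mul_nonneg (by linarith) (sq_nonneg Γ)
  refine ⟨M ^ (10 * μ) * (4 * M + (1 + 27 * K) * Γ) + (1 + 27 * K) * Γ + (4 + 5 * Λ) * Γ ^ 2,
    by linarith, fun a ha => ⟨c, hc, ?_⟩⟩
  intro T τ A t₁ x₀ u p k hframe hτ htypeI hL3 hA ht₁ hbad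
  -- the level scale `s`, its root `q`, the witness radius `r = Γ q`
  set s : ℝ := levelScale a t₁ (k + 1) with hs_def
  have hs_pos : 0 < s := mul_pos ht₁.1 (Real.exp_pos _)
  set q : ℝ := Real.sqrt s with hq_def
  have hq0 : 0 < q := Real.sqrt_pos.2 hs_pos
  set r : ℝ := Γ * q with hr_def
  have hr0 : 0 ≤ r := mul_nonneg hΓ0 hq0.le
  have hr2 : r ^ 2 = Γ ^ 2 * s := by rw [hr_def, mul_pow, hq_def, Real.sq_sqrt hs_pos.le]
  -- `e^a` dominates `a ≥ a₀ ≥ 0`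
  have ha0 : 0 ≤ a := by linarith
  have hexp1 : a + 1 ≤ Real.exp a := Real.add_one_le_exp a
  have hcoef : M ^ (10 * μ) * (4 * M + (1 + 27 * K) * Γ) + (1 + 27 * K) * Γ ≤ a := by linarith
  have h9 : (4 + 5 * Λ) * Γ ^ 2 ≤ Real.exp a := by linarith
  -- room: `(4 + 5Λ) r² ≤ t₁` (hence `9 r² ≤ t₁` for E1 and `Λ σ² ≤ t` for E2)
  have hroom : (4 + 5 * Λ) * r ^ 2 ≤ t₁ := by
    have hs_le : s ≤ t₁ * Real.exp (-a) := by
      have e : s = t₁ * Real.exp (-2 * a * ((k : ℝ) + 1)) := by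
        simp only [hs_def, levelScale, Nat.cast_add, Nat.cast_one]
      rw [e]
      refine mul_le_mul_of_nonneg_left (Real.exp_le_exp.2 ?_) ht₁.1.le
      nlinarith [mul_nonneg ha0 (Nat.cast_nonneg k : (0 : ℝ) ≤ k)]
    have hea : Real.exp a * Real.exp (-a) = 1 := by rw [← Real.exp_add]; simp
    calc (4 + 5 * Λ) * r ^ 2 = (4 + 5 * Λ) * Γ ^ 2 * s := by rw [hr2]; ring
      _ ≤ (4 + 5 * Λ) * Γ ^ 2 * (t₁ * Real.exp (-a)) := mul_le_mul_of_nonneg_left hs_le hΓ2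
      _ = ((4 + 5 * Λ) * Γ ^ 2) * Real.exp (-a) * t₁ := by ring
      _ ≤ Real.exp a * Real.exp (-a) * t₁ :=
          mul_le_mul_of_nonneg_right (mul_le_mul_of_nonneg_right h9 (Real.exp_nonneg _)) ht₁.1.le
      _ = t₁ := by rw [hea, one_mul]
  -- the candidate annulus `R := 4Mq + (1+27K) r`
  set R : ℝ := 4 * M * q + (1 + 27 * K) * r with hR_def
  have h27r : 0 ≤ (1 + 27 * K) * r := mul_nonneg (by linarith) hr0
  have hc1 : 4 * M * q ≤ R := by linarith
  have hc2 : M ^ (10 * μ) * R ≤ Real.exp a * q := by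
    have e : M ^ (10 * μ) * R = (M ^ (10 * μ) * (4 * M + (1 + 27 * K) * Γ)) * q := by
      rw [hR_def, hr_def]; ring
    rw [e]
    exact mul_le_mul_of_nonneg_right (by linarith) hq0.le
  -- the level is bad: this annulus is violated
  have hviol : ¬ ∀ t ∈ Icc (t₁ - s / 32) t₁, ∀ x : E3, R < ‖x - x₀‖ → ‖x - x₀‖ < M ^ (10 * μ) * R →
      ∀ j : ℕ, j ≤ 2 → ‖iteratedFDeriv ℝ j (u t) x‖ ≤ M ^ (-(3 * μ)) * s ^ (-(((j : ℝ) + 1) / 2)) :=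
    fun hq => hbad ⟨R, hc1, hc2, hq⟩
  -- E1: a hot witness near the annulus, late
  have hroom9 : 9 * r ^ 2 ≤ t₁ := by
    linarith [mul_nonneg (sub_nonneg.2 hΛ) (sq_nonneg r)]
  obtain ⟨y, t, hhot, htle, htlate, hclock, hyl, hyu⟩ :=
    hW T τ u p hframe hτ htypeI a t₁ x₀ k R ht₁ hroom9 hc1 hc2 hviol
  simp only [← hs_def, ← hq_def, ← hr_def] at htlate hclock hyl hyu
  -- K1: its terminal descendant
  have ht₁T : t₁ < T + τ := by linarith [ht₁.2]
  obtain ⟨y', t', hhot', hterm', htt', ht'le, hdist⟩ :=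
    exists_terminal_descendant (K := K) hK0 ht₁T hhot htle
  -- E2: the ember (room: `Λ(T'−t') ≤ Λ(T'−t) ≤ 5Λr² ≤ t₁ − 4r² ≤ t ≤ t'`)
  have hroomE : Λ * (T + τ - t') ≤ t' := by
    have h1 : Λ * (T + τ - t') ≤ Λ * (T + τ - t) := mul_le_mul_of_nonneg_left (by linarith) hΛ0
    have h2 : Λ * (T + τ - t) ≤ Λ * (5 * r ^ 2) := mul_le_mul_of_nonneg_left hclock hΛ0
    linarith
  have hember := hE T τ u p hframe hτ htypeI t₁ y' t' ht₁ ht'le hroomE hhot' hterm'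
  -- the ember ball lies inside the level shell
  have hσ : Real.sqrt (T + τ - t) ≤ 3 * r := by
    have e9 : (3 * r) ^ 2 = 9 * r ^ 2 := by ring
    calc Real.sqrt (T + τ - t) ≤ Real.sqrt ((3 * r) ^ 2) :=
          Real.sqrt_le_sqrt (by rw [e9]; linarith [sq_nonneg r])
      _ = 3 * r := Real.sqrt_sq (by positivity)
  have hσ' : Real.sqrt (T + τ - t') ≤ Real.sqrt (T + τ - t) := Real.sqrt_le_sqrt (by linarith)
  have hd24 : ‖y' - y‖ ≤ 24 * K * r := by
    calc ‖y' - y‖ ≤ 8 * K * (Real.sqrt (T + τ - t) - Real.sqrt (T + τ - t')) := hdist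
      _ ≤ 8 * K * (3 * r) := by
          refine mul_le_mul_of_nonneg_left ?_ (by positivity)
          linarith [Real.sqrt_nonneg (T + τ - t')]
      _ = 24 * K * r := by ring
  have hup : M ^ (10 * μ) * R + r + 24 * K * r + 3 * K * r < Real.exp a * q := by
    have e : M ^ (10 * μ) * R + r + 24 * K * r + 3 * K * r =
        (M ^ (10 * μ) * (4 * M + (1 + 27 * K) * Γ) + (1 + 27 * K) * Γ) * q := by
      rw [hR_def, hr_def]; ring
    rw [e]
    exact mul_lt_mul_of_pos_right (by linarith) hq0
  have hsub : ball y' (K * Real.sqrt (T + τ - t')) ⊆ levelShell M a t₁ x₀ (k + 1) := by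
    intro x hx
    rw [mem_ball, dist_eq_norm] at hx
    have hx3 : ‖x - y'‖ < 3 * K * r := by
      calc ‖x - y'‖ < K * Real.sqrt (T + τ - t') := hx
        _ ≤ K * (3 * r) := mul_le_mul_of_nonneg_left (hσ'.trans hσ) hK0
        _ = 3 * K * r := by ring
    have htri₁ : ‖y - x₀‖ ≤ ‖y' - y‖ + ‖x - y'‖ + ‖x - x₀‖ := by
      calc ‖y - x₀‖ = ‖(y - y') + (y' - x) + (x - x₀)‖ := by congr 1; abel
        _ ≤ ‖y - y'‖ + ‖y' - x‖ + ‖x - x₀‖ := norm_add₃_le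
        _ = ‖y' - y‖ + ‖x - y'‖ + ‖x - x₀‖ := by rw [norm_sub_rev y y', norm_sub_rev y' x]
    have htri₂ : ‖x - x₀‖ ≤ ‖x - y'‖ + ‖y' - y‖ + ‖y - x₀‖ := by
      calc ‖x - x₀‖ = ‖(x - y') + (y' - y) + (y - x₀)‖ := by congr 1; abel
        _ ≤ ‖x - y'‖ + ‖y' - y‖ + ‖y - x₀‖ := norm_add₃_le
    show 4 * M * q < ‖x - x₀‖ ∧ ‖x - x₀‖ < Real.exp a * q
    constructor
    · linarith
    · linarith
  exact hember.trans (lintegral_mono_set hsub)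

/-- The v1.1 edge by name: E1 + E2 ⇒ G1♯. -/
theorem flarePersistence_of_hotWitness_of_terminalEmber (h1 : HotWitness) (h2 : TerminalEmber) :
    FlarePersistence :=
  flarePersistence_of_hotWitness_of_terminalEmberM h1 (terminalEmberM_of_terminalEmber h2)

/-- `FlarePersistence` with the stubs plugged in (sorries = `stub_hotWitnessNear`, `stub_terminalEmberM`). -/
theorem flarePersistence_of_stubs : FlarePersistence :=
  flarePersistence_of_hotWitness_of_terminalEmberM stub_hotWitness stub_terminalEmberM

/-! ## 4. The rung, by the tree's kernels (`…BeadCensusKernel`) -/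

/-- The census with the stubs plugged in (tree kernel `BeadCensus.beadCensus_of_flarePersistence`). -/
theorem beadCensus_of_stub : BeadCensus := beadCensus_of_flarePersistence flarePersistence_of_stubs

/-- **The line's board edge** with the stubs plugged in: the rung `CubicRung.TypeIQuantCubicExp` (sorries = exactly
`stub_hotWitnessNear`, `stub_terminalEmberM`, `stub_bpChainRate`; tree kernel
`BeadCensus.typeIQuantCubicExp_of_flarePersistence_of_bpChainRate`). -/
theorem typeIQuantCubicExp_of_stubs : TypeIQuantCubicExp :=
  typeIQuantCubicExp_of_flarePersistence_of_bpChainRate flarePersistence_of_stubs stub_bpChainRate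

end

end Summit.NavierStokesRegularity.NavierStokesRegularity.Cruxes.TypeIQuantSubcubicExp.EmberCensus
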